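import Summits.CriticalPhenomena.PercolationContinuityZ3.Theorems.PercNearOneGluingNoHeavyLowerTailSunflowerPartitionLemma
import Summits.CriticalPhenomena.PercolationContinuityZ3.Theorems.PercNearOneGluingNoHeavyLowerTailSunflowerWeightedGladkov
import HarnessLib
import HarnessLib.Audit

/-!
# `NoHeavyLowerTail` (crux stmt-CriticalPhenomena-4575), abstract sunflower cubic: SPECTATOR FORM of the partition functionals and the
# WEAKER partition lemmas for the `G`- and `T`-rows (typed conjectures `PartitionLemmaG`, `PartitionLemmaT`, implied by `PartitionLemmaH`)

Support file (seat `prim-ineq-prove-1` gen 27; `--supports stmt-CriticalPhenomena-4575`; companion of `…SunflowerAntipodalGladkov` (p214186),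
`…SunflowerPartitionLemma` (p214317), `…SunflowerWeightedGladkov` (p218772, `kk_comm`)).  Nothing is asserted about the crux; no `sorry`; the two `@[conjecture]` definitions are obligations of the
programme, never facts.  Memo: run/shared/lean/prim/prim-ineq-prove-1/SPECTATOR-ROWS-prove1-g27.md.

SETTING (`SunflowerPartition.Sunflower`): a monotone map `lab : 2^α → M₃` (`0` bottom `B`, `1,2,3` petals `C_i`, `4` top `A`); ordered 3-partitions
`(P¹,P²,P³)` of `α` (`parts`); the Gladkov kernel `kk` (`+1` on `{top, bottom}`, `−1` on two distinct petals).  The three cubic rows of the abstract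
sunflower cubic (memo ABSTRACT-SUNFLOWER-CUBIC-prove1-g25 §1), homogenised with `σ = a + b + c₁ + c₂ + c₃`:
  `H = (a+b)·AG − e₃(c)`,   `G = σ·AG − e₃(c)`,   `T = (σ+a)·AG − e₃(c)`,   `AG = ab − e₂(c)`;
`T` is the E3GRP row `γ` / Sahi's `E₃` of the complements of a sunflower (`Literature…sahiE3_compl_sunflower_eq`), `H` is prove-1's sharp corner.

SPECTATOR FORM (this work).  Six times the polarisation of `x·AG` (`x` a cell mass) is "block of label `x` as SPECTATOR times `kk` on the other two
blocks"; hence with the rainbow indicator `triP` (three pairwise distinct petals, `= 6·e₃` polarised):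
* `s6H = [x ∈ {0,4}]·kk y z + [y ∈ {0,4}]·kk x z + [z ∈ {0,4}]·kk x y − triP`   (`s6H_eq_spec`, `decide`),
* `s6G = kk y z + kk x z + kk x y − triP`,  `s6T = s6G + [x = 4]·kk y z + [y = 4]·kk x z + [z = 4]·kk x y`   (definitions).
For a sunflower `F` and a spectator weight `w : Fin 5 → ℤ` put `Sw w := Σ_{(P¹,P²,P³)} w (lab P¹) · kk (lab P²) (lab P³)`: by `Sunflower.antipodal_gladkov`
on the cube `2^{(P¹)ᶜ}`, **`Sw w ≥ 0` whenever `w ≥ 0`** (`Sw_nonneg`).  With `Ntri := Σ triP` (`= 6 ×` the number of rainbow tri-petal partitions):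
  `ZH = 3·Sw 1_{0,4} − Ntri`,   `ZG = 3·Sw 1 − Ntri = ZH + 3·Sw 1_{petals}`,   `ZT = ZG + 3·Sw 1_{4}`
(`ZH_eq_spec`, `ZG_eq_spec`, `ZT_eq_spec`, `ZG_eq_ZH_add`, `ZT_eq_ZG_add`; block-relabelling symmetry `sum_parts_swap12/13`).  CONSEQUENCES:
* `ZH ≤ ZG ≤ ZT` (`ZH_le_ZG`, `ZG_le_ZT`): the partition lemma for `H` implies those for `G` and `T`
  (`partitionLemmaG_of_H`, `partitionLemmaT_of_G`, `partitionLemmaT_of_H`); the companion `…SunflowerPartitionLemmaTGamma` shows that the WEAKEST of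
  the three, `PartitionLemmaT`, already gives `γ` (`GammaRow`) through prim-l12-p2's kernel-generic transfer `Mk_bern_nonneg_of_Zk_nonneg`.
* The rainbow tri-petal count is the ONLY negative term: `ZH ≥ 0` (hence `ZG, ZT ≥ 0`) for every sunflower with `Ntri = 0`, e.g. whenever some petal is
  empty (`ZH_nonneg_of_Ntri_eq_zero`) — the two-petal partition lemma is a theorem.
* In counting language: `★_H ⟺ Σ_{X ∈ A ∪ B} σ(α∖X) ≥ 2·N₁₂₃`, `★_G ⟺ Σ_{X ⊆ α} σ(α∖X) ≥ 2·N₁₂₃`, `★_T ⟺ Σ_X σ + Σ_{X∈A} σ ≥ 2·N₁₂₃`, where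
  `σ(W) ≥ 0` is the antipodal Gladkov surplus of the cube `2^W` and `N₁₂₃` the number of ordered partitions labelled `(1,2,3)`.
CENSUS / NO-GO (memo): all three are exhaustively true for `|α| ≤ 5` (g25 §2, ttrl cp-r2); the bottom+petal spectators alone do NOT pay for the rainbow
partitions even in `G` (`Σ_{X ∉ A} σ ≥ 2N₁₂₃` fails on the tripled star `{j~k}_i`, `|α| = 9`: `432+38+216` vs `2N₁₂₃ = 432` needs the kernel spectators).
-/

namespace Summit.CriticalPhenomena.PercolationContinuityZ3.Theorems.SunflowerPartition

open Finset

/-! ## Kernels in spectator form -/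

/-- Indicator of a RAINBOW triple: three pairwise distinct petals (`6 ×` the polarisation of `e₃(c)`). [this work] -/
def triP (x y z : Fin 5) : ℤ :=
  if x ≠ 0 ∧ x ≠ 4 ∧ y ≠ 0 ∧ y ≠ 4 ∧ z ≠ 0 ∧ z ≠ 4 ∧ x ≠ y ∧ x ≠ z ∧ y ≠ z then 1 else 0

/-- `6 ×` the polarised `G`-row `σ·(ab − e₂(c)) − e₃(c)`: every block as spectator with the Gladkov kernel on the other two, minus the rainbow
indicator. [this work] -/
def s6G (x y z : Fin 5) : ℤ := kk y z + kk x z + kk x y - triP x y z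

/-- `6 ×` the polarised `T`-row `(σ + a)·(ab − e₂(c)) − e₃(c)` (= the E3GRP row `γ` / Sahi's `E₃` of the complements): `s6G` plus the kernel block
as an extra spectator. [this work] -/
def s6T (x y z : Fin 5) : ℤ :=
  s6G x y z + (if x = 4 then 1 else 0) * kk y z + (if y = 4 then 1 else 0) * kk x z + (if z = 4 then 1 else 0) * kk x y

/-- `triP` vanishes unless all three entries are distinct petals (sanity). [this work] -/
theorem triP_nonneg : ∀ x y z : Fin 5, 0 ≤ triP x y z := by decide

/-- **Spectator form of `s6H`**: the top-or-bottom blocks as spectators with the Gladkov kernel on the other two, minus the rainbow indicator.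
[this work] -/
theorem s6H_eq_spec : ∀ x y z : Fin 5, s6H x y z =
    (if x = 0 ∨ x = 4 then 1 else 0) * kk y z + (if y = 0 ∨ y = 4 then 1 else 0) * kk x z +
      (if z = 0 ∨ z = 4 then 1 else 0) * kk x y - triP x y z := by
  decide

/-- The value table of `s6T` (`0` bottom, `1,2,3` petals, `4` top). [this work] -/
theorem s6T_table : ∀ x y z : Fin 5, s6T x y z =
    (![![![0, 0, 0, 0, 2], ![0, 0, -1, -1, 1], ![0, -1, 0, -1, 1], ![0, -1, -1, 0, 1], ![2, 1, 1, 1, 4]],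
      ![![0, 0, -1, -1, 1], ![0, 0, -2, -2, 0], ![-1, -2, -2, -4, -2], ![-1, -2, -4, -2, -2], ![1, 0, -2, -2, 0]],
      ![![0, -1, 0, -1, 1], ![-1, -2, -2, -4, -2], ![0, -2, 0, -2, 0], ![-1, -4, -2, -2, -2], ![1, -2, 0, -2, 0]],
      ![![0, -1, -1, 0, 1], ![-1, -2, -4, -2, -2], ![-1, -4, -2, -2, -2], ![0, -2, -2, 0, 0], ![1, -2, -2, 0, 0]],
      ![![2, 1, 1, 1, 4], ![1, 0, -2, -2, 0], ![1, -2, 0, -2, 0], ![1, -2, -2, 0, 0], ![4, 0, 0, 0, 0]]] :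
      Fin 5 → Fin 5 → Fin 5 → ℤ) x y z := by
  decide

/-- The value table of `s6G`. [this work] -/
theorem s6G_table : ∀ x y z : Fin 5, s6G x y z =
    (![![![0, 0, 0, 0, 2], ![0, 0, -1, -1, 1], ![0, -1, 0, -1, 1], ![0, -1, -1, 0, 1], ![2, 1, 1, 1, 2]],
      ![![0, 0, -1, -1, 1], ![0, 0, -2, -2, 0], ![-1, -2, -2, -4, -1], ![-1, -2, -4, -2, -1], ![1, 0, -1, -1, 0]],
      ![![0, -1, 0, -1, 1], ![-1, -2, -2, -4, -1], ![0, -2, 0, -2, 0], ![-1, -4, -2, -2, -1], ![1, -1, 0, -1, 0]],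
      ![![0, -1, -1, 0, 1], ![-1, -2, -4, -2, -1], ![-1, -4, -2, -2, -1], ![0, -2, -2, 0, 0], ![1, -1, -1, 0, 0]],
      ![![2, 1, 1, 1, 2], ![1, 0, -1, -1, 0], ![1, -1, 0, -1, 0], ![1, -1, -1, 0, 0], ![2, 0, 0, 0, 0]]] :
      Fin 5 → Fin 5 → Fin 5 → ℤ) x y z := by
  decide

/-- The indicator weights used below: `1 = 1_{0,4} + 1_{petals}` pointwise. [this work] -/
theorem one_eq_ind_add : ∀ v : Fin 5,
    (1 : ℤ) = (if v = 0 ∨ v = 4 then 1 else 0) + (if v ≠ 0 ∧ v ≠ 4 then 1 else 0) := by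
  decide

/-! ## Block-relabelling symmetries of sums over ordered 3-partitions -/

variable {α : Type*} [Fintype α] [DecidableEq α]

omit [Fintype α] in
/-- For disjoint `S, T`: `((S ∪ T)ᶜ ∪ T)ᶜ = S` (in a finite type). [folklore] -/
theorem compl_union_compl_eq [Fintype α] {S T : Finset α} (h : Disjoint S T) : ((S ∪ T)ᶜ ∪ T)ᶜ = S := by
  ext x
  simp only [mem_compl, mem_union]
  have hd : x ∈ S → x ∉ T := fun hx => Finset.disjoint_left.1 h hx
  tauto

/-- Swapping the first two blocks. [this work] -/
theorem sum_parts_swap12 (f : Finset α → Finset α → Finset α → ℤ) :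
    ∑ q ∈ parts α, f q.1 q.2 (q.1 ∪ q.2)ᶜ = ∑ q ∈ parts α, f q.2 q.1 (q.1 ∪ q.2)ᶜ := by
  refine sum_nbij' (fun q => (q.2, q.1)) (fun q => (q.2, q.1)) ?_ ?_ ?_ ?_ ?_
  · intro q hq
    unfold parts at hq ⊢
    rw [mem_filter] at hq ⊢
    exact ⟨mem_univ _, hq.2.symm⟩
  · intro q hq
    unfold parts at hq ⊢
    rw [mem_filter] at hq ⊢
    exact ⟨mem_univ _, hq.2.symm⟩
  · intro q _; rfl
  · intro q _; rfl
  · intro q _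
    simp only [union_comm]

/-- Swapping the first and third blocks. [this work] -/
theorem sum_parts_swap13 (f : Finset α → Finset α → Finset α → ℤ) :
    ∑ q ∈ parts α, f q.1 q.2 (q.1 ∪ q.2)ᶜ = ∑ q ∈ parts α, f (q.1 ∪ q.2)ᶜ q.2 q.1 := by
  refine sum_nbij' (fun q => ((q.1 ∪ q.2)ᶜ, q.2)) (fun q => ((q.1 ∪ q.2)ᶜ, q.2)) ?_ ?_ ?_ ?_ ?_
  · intro q _
    unfold parts
    rw [mem_filter]
    exact ⟨mem_univ _, disjoint_compl_left.mono_right subset_union_right⟩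
  · intro q _
    unfold parts
    rw [mem_filter]
    exact ⟨mem_univ _, disjoint_compl_left.mono_right subset_union_right⟩
  · intro q hq
    unfold parts at hq
    rw [mem_filter] at hq
    simp only [compl_union_compl_eq hq.2]
  · intro q hq
    unfold parts at hq
    rw [mem_filter] at hq
    simp only [compl_union_compl_eq hq.2]
  · intro q hq
    unfold parts at hq
    rw [mem_filter] at hq
    simp only [compl_union_compl_eq hq.2]

/-! ## Spectator sums and the three partition functionals -/

namespace Sunflower

variable (F : Sunflower α)

/-- `ZG = Σ_{ordered 3-partitions} s6G` (partition functional of the `G`-row). [this work] -/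
def ZG : ℤ := ∑ q ∈ parts α, s6G (F.lab q.1) (F.lab q.2) (F.lab (q.1 ∪ q.2)ᶜ)

/-- `ZT = Σ_{ordered 3-partitions} s6T` (partition functional of the `T`-row = `γ`). [this work] -/
def ZT : ℤ := ∑ q ∈ parts α, s6T (F.lab q.1) (F.lab q.2) (F.lab (q.1 ∪ q.2)ᶜ)

/-- `Ntri = Σ triP` = the number of ordered 3-partitions labelled by three pairwise distinct petals (`6 ×` the number of rainbow tri-petal
partitions). [this work] -/
def Ntri : ℤ := ∑ q ∈ parts α, triP (F.lab q.1) (F.lab q.2) (F.lab (q.1 ∪ q.2)ᶜ)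

/-- The SPECTATOR SUM with weight `w` on the label of the spectator block: `Σ_{(P¹,P²,P³)} w (lab P¹) · kk (lab P²) (lab P³)`. [this work] -/
def Sw (w : Fin 5 → ℤ) : ℤ := ∑ q ∈ parts α, w (F.lab q.1) * kk (F.lab q.2) (F.lab (q.1 ∪ q.2)ᶜ)

/-- **Spectator sums with nonnegative weights are nonnegative** (antipodal Gladkov on the complement of the spectator block). [this work] -/
theorem Sw_nonneg (w : Fin 5 → ℤ) (hw : ∀ v, 0 ≤ w v) : 0 ≤ F.Sw w := by
  unfold Sw
  rw [sum_parts_eq (f := fun S T => w (F.lab S) * kk (F.lab T) (F.lab (S ∪ T)ᶜ))]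
  refine sum_nonneg fun S _ => ?_
  rw [← mul_sum]
  refine mul_nonneg (hw _) ?_
  have h := F.antipodal_gladkov Sᶜ
  refine le_of_le_of_eq h (sum_congr rfl fun T _ => ?_)
  rw [compl_union, sdiff_eq_inter_compl]

/-- `Ntri ≥ 0`. [this work] -/
theorem Ntri_nonneg : 0 ≤ F.Ntri := by
  unfold Ntri
  exact sum_nonneg fun q _ => triP_nonneg _ _ _

/-- `Sw` is additive in the weight. [this work] -/
theorem Sw_add (w₁ w₂ : Fin 5 → ℤ) : F.Sw (fun v => w₁ v + w₂ v) = F.Sw w₁ + F.Sw w₂ := by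
  unfold Sw
  rw [← sum_add_distrib]
  exact sum_congr rfl fun q _ => by ring

/-- The symmetrised spectator kernel sums to `3 · Sw` (block-relabelling symmetry). [this work] -/
theorem sum_spec_eq (w : Fin 5 → ℤ) :
    ∑ q ∈ parts α, (w (F.lab q.1) * kk (F.lab q.2) (F.lab (q.1 ∪ q.2)ᶜ) + w (F.lab q.2) * kk (F.lab q.1) (F.lab (q.1 ∪ q.2)ᶜ) +
        w (F.lab (q.1 ∪ q.2)ᶜ) * kk (F.lab q.1) (F.lab q.2)) = 3 * F.Sw w := by
  rw [sum_add_distrib, sum_add_distrib]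
  have h2 : ∑ q ∈ parts α, w (F.lab q.2) * kk (F.lab q.1) (F.lab (q.1 ∪ q.2)ᶜ) = F.Sw w := by
    unfold Sw
    exact sum_parts_swap12 (fun A B C => w (F.lab B) * kk (F.lab A) (F.lab C))
  have h3 : ∑ q ∈ parts α, w (F.lab (q.1 ∪ q.2)ᶜ) * kk (F.lab q.1) (F.lab q.2) = F.Sw w := by
    rw [show (∑ q ∈ parts α, w (F.lab (q.1 ∪ q.2)ᶜ) * kk (F.lab q.1) (F.lab q.2)) =
        ∑ q ∈ parts α, w (F.lab q.1) * kk (F.lab (q.1 ∪ q.2)ᶜ) (F.lab q.2) from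
      sum_parts_swap13 (fun A B C => w (F.lab C) * kk (F.lab A) (F.lab B))]
    unfold Sw
    exact sum_congr rfl fun q _ => by rw [kk_comm]
  rw [h2, h3]
  unfold Sw
  ring

/-- **`ZH` in spectator form**: `ZH = 3·Sw 1_{0,4} − Ntri`. [this work] -/
theorem ZH_eq_spec : F.ZH = 3 * F.Sw (fun v => if v = 0 ∨ v = 4 then 1 else 0) - F.Ntri := by
  rw [← F.sum_spec_eq]
  unfold ZH Ntri
  rw [← sum_sub_distrib]
  exact sum_congr rfl fun q _ => s6H_eq_spec _ _ _

/-- **`ZG` in spectator form**: `ZG = 3·Sw 1 − Ntri`. [this work] -/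
theorem ZG_eq_spec : F.ZG = 3 * F.Sw (fun _ => 1) - F.Ntri := by
  rw [← F.sum_spec_eq]
  unfold ZG Ntri s6G
  rw [← sum_sub_distrib]
  exact sum_congr rfl fun q _ => by ring

/-- **`ZT` in spectator form**: `ZT = 3·Sw 1 + 3·Sw 1_{4} − Ntri`. [this work] -/
theorem ZT_eq_spec : F.ZT = 3 * F.Sw (fun _ => 1) + 3 * F.Sw (fun v => if v = 4 then 1 else 0) - F.Ntri := by
  rw [← F.sum_spec_eq, ← F.sum_spec_eq]
  unfold ZT Ntri s6T s6G
  rw [← sum_add_distrib, ← sum_sub_distrib]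
  exact sum_congr rfl fun q _ => by ring

/-- `ZG = ZH + 3·Sw 1_{petals}`. [this work] -/
theorem ZG_eq_ZH_add : F.ZG = F.ZH + 3 * F.Sw (fun v => if v ≠ 0 ∧ v ≠ 4 then 1 else 0) := by
  rw [F.ZG_eq_spec, F.ZH_eq_spec]
  have h : F.Sw (fun _ => 1) = F.Sw (fun v => if v = 0 ∨ v = 4 then 1 else 0) + F.Sw (fun v => if v ≠ 0 ∧ v ≠ 4 then 1 else 0) := by
    rw [← F.Sw_add]
    unfold Sw
    exact sum_congr rfl fun q _ => by beta_reduce; rw [← one_eq_ind_add]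
  rw [h]
  ring

/-- `ZT = ZG + 3·Sw 1_{4}` (= `ZG + ZA`). [this work] -/
theorem ZT_eq_ZG_add : F.ZT = F.ZG + 3 * F.Sw (fun v => if v = 4 then 1 else 0) := by
  rw [F.ZT_eq_spec, F.ZG_eq_spec]
  ring

/-- `ZH ≤ ZG`. [this work] -/
theorem ZH_le_ZG : F.ZH ≤ F.ZG := by
  rw [F.ZG_eq_ZH_add]
  have h := F.Sw_nonneg (fun v => if v ≠ 0 ∧ v ≠ 4 then 1 else 0) fun v => by split_ifs <;> norm_num
  linarith

/-- `ZG ≤ ZT`. [this work] -/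
theorem ZG_le_ZT : F.ZG ≤ F.ZT := by
  rw [F.ZT_eq_ZG_add]
  have h := F.Sw_nonneg (fun v => if v = 4 then 1 else 0) fun v => by split_ifs <;> norm_num
  linarith

/-- **The rainbow count is the only obstruction**: `ZH + Ntri ≥ 0`; in particular `ZH ≥ 0` whenever `Ntri = 0` (no rainbow tri-petal partition,
e.g. some petal empty — the two-petal partition lemma). [this work] -/
theorem ZH_add_Ntri_nonneg : 0 ≤ F.ZH + F.Ntri := by
  rw [F.ZH_eq_spec]
  have h := F.Sw_nonneg (fun v => if v = 0 ∨ v = 4 then 1 else 0) fun v => by split_ifs <;> norm_num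
  linarith

/-- `ZH ≥ 0` for every sunflower without rainbow tri-petal partitions. [this work] -/
theorem ZH_nonneg_of_Ntri_eq_zero (h : F.Ntri = 0) : 0 ≤ F.ZH := by
  have := F.ZH_add_Ntri_nonneg
  linarith

omit [Fintype α] in
/-- A set labelled by the petal value `i + 1` lies in `V i` and not in the kernel. [this work] -/
theorem mem_V_of_lab_val (S : Finset α) (i : Fin 3) (h : (F.lab S).val = i.val + 1) : S ∈ F.V i ∧ S ∉ F.A := by
  unfold Sunflower.lab at h
  fin_cases i <;> (split_ifs at h <;> simp_all)

/-- A sunflower one of whose petals is empty has no rainbow partition. [this work] -/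
theorem Ntri_eq_zero_of_petal_empty (i : Fin 3) (hi : F.V i ⊆ F.A) : F.Ntri = 0 := by
  have key : ∀ S : Finset α, (F.lab S).val ≠ i.val + 1 := fun S h =>
    (F.mem_V_of_lab_val S i h).2 (hi (F.mem_V_of_lab_val S i h).1)
  unfold Ntri
  refine sum_eq_zero fun q _ => ?_
  unfold triP
  split_ifs with hc
  · exfalso
    obtain ⟨hx0, hx4, hy0, hy4, hz0, hz4, hxy, hxz, hyz⟩ := hc
    have h1 := key q.1
    have h2 := key q.2
    have h3 := key (q.1 ∪ q.2)ᶜ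
    omega
  · rfl

end Sunflower

/-! ## The weaker partition lemmas (typed conjectures) and the implications `H ⇒ G ⇒ T` -/

/-- **PARTITION LEMMA FOR THE `G`-ROW** (this work; OPEN; census-clean for `|α| ≤ 5`, memo g25 §2): `0 ≤ ZG` for every finite sunflower of up-sets;
equivalently the total antipodal-Gladkov surplus over ALL spectator blocks pays twice the rainbow count.  Weaker than `PartitionLemmaH`
(`partitionLemmaG_of_H`); gives the law-level row `σ·(ab − e₂) − e₃ ≥ 0` (AG⁺, `G₄`).  An obligation, never a fact: use as `(h : PartitionLemmaG)`.
[status: open] -/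
@[conjecture] def PartitionLemmaG : Prop :=
  ∀ (α : Type) [Fintype α] [DecidableEq α] (F : Sunflower α), 0 ≤ F.ZG

/-- **PARTITION LEMMA FOR THE `T`-ROW** (this work; OPEN; census-clean for `|α| ≤ 5`, memo g25 §2): `0 ≤ ZT` for every finite sunflower of up-sets.
The WEAKEST of the three (`partitionLemmaT_of_G`, `partitionLemmaT_of_H`) and already sufficient for `γ` = `GammaRow` (companion
`…SunflowerPartitionLemmaTGamma`).  An obligation, never a fact: use as `(h : PartitionLemmaT)`. [status: open] -/
@[conjecture] def PartitionLemmaT : Prop :=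
  ∀ (α : Type) [Fintype α] [DecidableEq α] (F : Sunflower α), 0 ≤ F.ZT

/-- `PartitionLemmaH ⇒ PartitionLemmaG`. [this work] -/
theorem partitionLemmaG_of_H (h : PartitionLemmaH) : PartitionLemmaG :=
  fun α _ _ F => le_trans (h α F) F.ZH_le_ZG

/-- `PartitionLemmaG ⇒ PartitionLemmaT`. [this work] -/
theorem partitionLemmaT_of_G (h : PartitionLemmaG) : PartitionLemmaT :=
  fun α _ _ F => le_trans (h α F) F.ZG_le_ZT

/-- `PartitionLemmaH ⇒ PartitionLemmaT`. [this work] -/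
theorem partitionLemmaT_of_H (h : PartitionLemmaH) : PartitionLemmaT :=
  partitionLemmaT_of_G (partitionLemmaG_of_H h)

end Summit.CriticalPhenomena.PercolationContinuityZ3.Theorems.SunflowerPartition
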